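import Literature.Algebra.Homology.EulerPoincareFormula
import HarnessLib

/-!
# The strong Morse inequalities for a complex of finite-dimensional vector spaces

Layer `Literature/Algebra/Homology` (pure linear algebra over Mathlib; proved theorems only, 0 definitions, 0 named facts, no
instances, no notation). The "standard linear algebra" behind Milnor's Morse inequalities (*Morse theory* §5: for a chain
complex with `c_λ = dim C_λ`, `b_λ = dim H_λ`, `Σ_{λ ≤ n} (−1)^{n−λ} (c_λ − b_λ) ≥ 0`) and Forman's Cor. 3.6, for Mathlib's
`HomologicalComplex` of finite-dimensional spaces over a division ring, `ℤ`-indexed and bounded below (`Cⁱ = 0` for `i < a`),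
with the EXACT DEFECT, from row `EulerPoincareFormula`'s `finrank_X_eq_finrank_homology_add` by induction on `n`:

* cochain form (`CochainComplex (ModuleCat K) ℤ`): `finrank_X_eq_cochain` (`dim Cⁱ = dim Hⁱ + rk dⁱ + rk dⁱ⁻¹`),
  **`sum_negOnePow_mul_finrank_sub_eq_finrank_range_d`**: `Σ_{i ∈ Icc a n} (−1)^{n−i} (dim Cⁱ − dim Hⁱ(C)) = rk (dⁿ : Cⁿ → Cⁿ⁺¹)`,
  **`strongMorseInequality_cochain`**: `Σ_{i ∈ Icc a n} (−1)^{n−i} dim Hⁱ(C) ≤ Σ_{i ∈ Icc a n} (−1)^{n−i} dim Cⁱ`, and the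
  truncated Euler–Poincaré identity `sum_negOnePow_mul_finrank_eq_of_d_eq_zero` when `dⁿ = 0`;
* chain form (`ChainComplex (ModuleCat K) ℤ`, cells ∕ Morse numbers): `finrank_X_eq_chain`,
  **`sum_negOnePow_mul_finrank_sub_eq_finrank_range_d_chain`** (`… = rk (∂ₙ₊₁ : Cₙ₊₁ → Cₙ)`), **`strongMorseInequality_chain`**.

NOT this statement (cited so no dedup arises): `Literature/AlgebraicTopology/DiscreteMorseTheory/AlgebraicMorseInequalities`
(Forman's WEAK inequality `dim (ker d₁ ⁄ im d₂) ≤ #critical cells` for based complexes with a discrete Morse matching) and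
`…/WeakMorseInequalities` (face posets of CW complexes + the NAMED FACT `Forman1998_weakMorseInequalities`; its docstring's
«Not vendored: the strong Morse inequalities» is the abstract half supplied here); `dim Hⁱ ≤ dim Cⁱ` alone is row
`EulerPoincareFormula`'s `finrank_homology_le`. Library only (cell `pub-hodge-ring2`, count-neutral); proves nothing about any
crux, route or conjecture.

## References

* J. Milnor, *Morse theory*, Ann. of Math. Studies 51 (1963), §5, Thm. 5.2 and the preceding lemma. [Milnor1963]
* R. Forman, *Morse theory for cell complexes*, Adv. Math. 134 (1998), Cor. 3.6 (strong Morse inequalities). [Forman1998]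
* S. Lang, *Algebra* (2002), Ch. XX §3. [Lang2002]
-/


open CategoryTheory CategoryTheory.Limits

universe v u

namespace Literature.Algebra.Homology.MorseInequalities

variable {K : Type u} [DivisionRing K]

/-- The rank of a linear map out of a trivial space is `0`. [cite: Lang2002, XX §3] -/
theorem finrank_range_eq_zero_of_isZero {X Y : ModuleCat.{v} K} (f : X ⟶ Y) (hX : IsZero X) :
    Module.finrank K (LinearMap.range f.hom) = 0 := by
  haveI := ModuleCat.subsingleton_of_isZero hX
  have h := LinearMap.finrank_range_le (M := X) f.hom
  have h0 : Module.finrank K X = 0 := Module.finrank_zero_of_subsingleton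
  omega

/-- `Icc a (n + 1) = insert (n + 1) (Icc a n)` on `ℤ` when `a ≤ n + 1`. [cite: Milnor1963, §5] -/
theorem Icc_add_one_eq_insert (a n : ℤ) (h : a ≤ n + 1) : Finset.Icc a (n + 1) = insert (n + 1) (Finset.Icc a n) := by
  ext i
  simp only [Finset.mem_Icc, Finset.mem_insert]
  omega

section Cochain

variable (C : CochainComplex (ModuleCat.{v} K) ℤ) [∀ i, Module.Finite K (C.X i)]

/-- `dim Cⁱ = dim Hⁱ(C) + rk dⁱ + rk dⁱ⁻¹` for a cochain complex on `ℤ`. [cite: Milnor1963, §5] -/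
theorem finrank_X_eq_cochain (i : ℤ) :
    Module.finrank K (C.X i) = Module.finrank K (C.homology i) +
      Module.finrank K (LinearMap.range (C.d i (i + 1)).hom) + Module.finrank K (LinearMap.range (C.d (i - 1) i).hom) := by
  have h := EulerPoincare.finrank_X_eq_finrank_homology_add C i
  have hn : (ComplexShape.up ℤ).next i = i + 1 := (ComplexShape.up ℤ).next_eq' (by simp)
  have hp : (ComplexShape.up ℤ).prev i = i - 1 := (ComplexShape.up ℤ).prev_eq' (by simp)
  rw [hn, hp] at h
  exact h

/-- **The strong Morse inequalities with exact defect (cochain form)**: for a cochain complex of finite-dimensional spaces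
with `Cⁱ = 0` for `i < a`, `Σ_{i ∈ Icc a n} (−1)^{n−i} (dim Cⁱ − dim Hⁱ(C)) = rk (dⁿ : Cⁿ → Cⁿ⁺¹)`.
[cite: Milnor1963, §5 Thm. 5.2] [cite: Forman1998, Cor. 3.6] -/
theorem sum_negOnePow_mul_finrank_sub_eq_finrank_range_d (a : ℤ) (hC : ∀ i, i < a → IsZero (C.X i)) (n : ℤ) :
    ∑ i ∈ Finset.Icc a n, ((n - i).negOnePow : ℤ) *
        ((Module.finrank K (C.X i) : ℤ) - (Module.finrank K (C.homology i) : ℤ)) =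
      (Module.finrank K (LinearMap.range (C.d n (n + 1)).hom) : ℤ) := by
  by_cases hn : a - 1 ≤ n
  · induction n, hn using Int.leInduction with
    | base =>
      rw [Finset.Icc_eq_empty (by omega), Finset.sum_empty, finrank_range_eq_zero_of_isZero _ (hC _ (by omega)),
        Nat.cast_zero]
    | succ n hmn ih =>
      rw [Icc_add_one_eq_insert a n (by omega), Finset.sum_insert (by simp), sub_self, Int.negOnePow_zero,
        Units.val_one, one_mul, finrank_X_eq_cochain C (n + 1), add_sub_cancel_right]
      have hs : ∑ i ∈ Finset.Icc a n, ((n + 1 - i).negOnePow : ℤ) *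
          ((Module.finrank K (C.X i) : ℤ) - (Module.finrank K (C.homology i) : ℤ)) =
          -∑ i ∈ Finset.Icc a n, ((n - i).negOnePow : ℤ) *
            ((Module.finrank K (C.X i) : ℤ) - (Module.finrank K (C.homology i) : ℤ)) := by
        rw [← Finset.sum_neg_distrib]
        refine Finset.sum_congr rfl fun i _ => ?_
        rw [show n + 1 - i = (n - i) + 1 by ring, Int.negOnePow_succ, Units.val_neg, neg_mul]
      rw [hs, ih]
      push_cast
      ring
  · rw [Finset.Icc_eq_empty (by omega), Finset.sum_empty, finrank_range_eq_zero_of_isZero _ (hC _ (by omega)),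
      Nat.cast_zero]

/-- **Strong Morse inequality (cochain form)**: `Σ_{i ∈ Icc a n} (−1)^{n−i} dim Hⁱ(C) ≤ Σ_{i ∈ Icc a n} (−1)^{n−i} dim Cⁱ`.
[cite: Milnor1963, §5 Thm. 5.2] [cite: Forman1998, Cor. 3.6] -/
theorem strongMorseInequality_cochain (a : ℤ) (hC : ∀ i, i < a → IsZero (C.X i)) (n : ℤ) :
    ∑ i ∈ Finset.Icc a n, ((n - i).negOnePow : ℤ) * (Module.finrank K (C.homology i) : ℤ) ≤
      ∑ i ∈ Finset.Icc a n, ((n - i).negOnePow : ℤ) * (Module.finrank K (C.X i) : ℤ) := by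
  have h := sum_negOnePow_mul_finrank_sub_eq_finrank_range_d C a hC n
  have h0 : (0 : ℤ) ≤ ∑ i ∈ Finset.Icc a n, ((n - i).negOnePow : ℤ) *
      ((Module.finrank K (C.X i) : ℤ) - (Module.finrank K (C.homology i) : ℤ)) := by
    rw [h]; exact Nat.cast_nonneg _
  rw [← sub_nonneg, ← Finset.sum_sub_distrib]
  simpa only [mul_sub] using h0

/-- **Truncated Euler–Poincaré**: if moreover `dⁿ = 0` (e.g. `Cⁿ⁺¹ = 0`), the strong Morse inequality at `n` is an
equality: `Σ_{i ∈ Icc a n} (−1)^{n−i} dim Cⁱ = Σ_{i ∈ Icc a n} (−1)^{n−i} dim Hⁱ(C)`. [cite: Milnor1963, §5 Thm. 5.2] -/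
theorem sum_negOnePow_mul_finrank_eq_of_d_eq_zero (a : ℤ) (hC : ∀ i, i < a → IsZero (C.X i)) (n : ℤ)
    (hd : C.d n (n + 1) = 0) :
    ∑ i ∈ Finset.Icc a n, ((n - i).negOnePow : ℤ) * (Module.finrank K (C.X i) : ℤ) =
      ∑ i ∈ Finset.Icc a n, ((n - i).negOnePow : ℤ) * (Module.finrank K (C.homology i) : ℤ) := by
  have h := sum_negOnePow_mul_finrank_sub_eq_finrank_range_d C a hC n
  rw [hd, ModuleCat.hom_zero, LinearMap.range_zero, finrank_bot, Nat.cast_zero] at h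
  rw [← sub_eq_zero, ← Finset.sum_sub_distrib, ← h]
  exact Finset.sum_congr rfl fun i _ => by ring

end Cochain
section Chain

variable (C : ChainComplex (ModuleCat.{v} K) ℤ) [∀ k, Module.Finite K (C.X k)]

/-- `dim Cₖ = dim Hₖ(C) + rk ∂ₖ + rk ∂ₖ₊₁` for a chain complex on `ℤ`. [cite: Milnor1963, §5] -/
theorem finrank_X_eq_chain (k : ℤ) :
    Module.finrank K (C.X k) = Module.finrank K (C.homology k) +
      Module.finrank K (LinearMap.range (C.d k (k - 1)).hom) + Module.finrank K (LinearMap.range (C.d (k + 1) k).hom) := by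
  have h := EulerPoincare.finrank_X_eq_finrank_homology_add C k
  have hn : (ComplexShape.down ℤ).next k = k - 1 := (ComplexShape.down ℤ).next_eq' (by simp)
  have hp : (ComplexShape.down ℤ).prev k = k + 1 := (ComplexShape.down ℤ).prev_eq' (by simp)
  rw [hn, hp] at h
  exact h

/-- **The strong Morse inequalities with exact defect (chain form, `c_k − b_k`)**: for a chain complex of finite-dimensional
spaces with `Cₖ = 0` for `k < a`, `Σ_{k ∈ Icc a n} (−1)^{n−k} (dim Cₖ − dim Hₖ(C)) = rk (∂ₙ₊₁ : Cₙ₊₁ → Cₙ)`.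
[cite: Milnor1963, §5 Thm. 5.2] [cite: Forman1998, Cor. 3.6] -/
theorem sum_negOnePow_mul_finrank_sub_eq_finrank_range_d_chain (a : ℤ) (hC : ∀ k, k < a → IsZero (C.X k)) (n : ℤ) :
    ∑ k ∈ Finset.Icc a n, ((n - k).negOnePow : ℤ) *
        ((Module.finrank K (C.X k) : ℤ) - (Module.finrank K (C.homology k) : ℤ)) =
      (Module.finrank K (LinearMap.range (C.d (n + 1) n).hom) : ℤ) := by
  by_cases hn : a - 1 ≤ n
  · induction n, hn using Int.leInduction with
    | base =>
      rw [Finset.Icc_eq_empty (by omega), Finset.sum_empty, sub_add_cancel]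
      -- `∂ₐ : Cₐ → C_{a-1}` lands in the zero space
      haveI := ModuleCat.subsingleton_of_isZero (hC (a - 1) (by omega))
      rw [Module.finrank_zero_of_subsingleton, Nat.cast_zero]
    | succ n hmn ih =>
      rw [Icc_add_one_eq_insert a n (by omega), Finset.sum_insert (by simp), sub_self, Int.negOnePow_zero,
        Units.val_one, one_mul, finrank_X_eq_chain C (n + 1), add_sub_cancel_right]
      have hs : ∑ k ∈ Finset.Icc a n, ((n + 1 - k).negOnePow : ℤ) *
          ((Module.finrank K (C.X k) : ℤ) - (Module.finrank K (C.homology k) : ℤ)) =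
          -∑ k ∈ Finset.Icc a n, ((n - k).negOnePow : ℤ) *
            ((Module.finrank K (C.X k) : ℤ) - (Module.finrank K (C.homology k) : ℤ)) := by
        rw [← Finset.sum_neg_distrib]
        refine Finset.sum_congr rfl fun k _ => ?_
        rw [show n + 1 - k = (n - k) + 1 by ring, Int.negOnePow_succ, Units.val_neg, neg_mul]
      rw [hs, ih, show n + 1 + 1 = n + 2 by ring]
      push_cast
      ring
  · rw [Finset.Icc_eq_empty (by omega), Finset.sum_empty, finrank_range_eq_zero_of_isZero _ (hC _ (by omega)),
      Nat.cast_zero]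

/-- **Strong Morse inequality (chain form)**: `Σ_{k ∈ Icc a n} (−1)^{n−k} bₖ ≤ Σ_{k ∈ Icc a n} (−1)^{n−k} cₖ` with
`cₖ = dim Cₖ`, `bₖ = dim Hₖ(C)`. [cite: Milnor1963, §5 Thm. 5.2] [cite: Forman1998, Cor. 3.6] -/
theorem strongMorseInequality_chain (a : ℤ) (hC : ∀ k, k < a → IsZero (C.X k)) (n : ℤ) :
    ∑ k ∈ Finset.Icc a n, ((n - k).negOnePow : ℤ) * (Module.finrank K (C.homology k) : ℤ) ≤
      ∑ k ∈ Finset.Icc a n, ((n - k).negOnePow : ℤ) * (Module.finrank K (C.X k) : ℤ) := by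
  have h := sum_negOnePow_mul_finrank_sub_eq_finrank_range_d_chain C a hC n
  have h0 : (0 : ℤ) ≤ ∑ k ∈ Finset.Icc a n, ((n - k).negOnePow : ℤ) *
      ((Module.finrank K (C.X k) : ℤ) - (Module.finrank K (C.homology k) : ℤ)) := by
    rw [h]; exact Nat.cast_nonneg _
  rw [← sub_nonneg, ← Finset.sum_sub_distrib]
  simpa only [mul_sub] using h0

end Chain
end Literature.Algebra.Homology.MorseInequalities
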